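import Literature.MathematicalPhysics.QuantumFieldTheory.Balaban1983to89.Setup
import Mathlib.Analysis.Normed.Group.Constructions
import Mathlib.Analysis.SpecialFunctions.Sqrt
import HarnessLib

/-!
# S2β · (SCT″-c)₁, S-KER LETTER 3 — «READ-CELL SELECTION FOR THE Pi-SUP»: the squared Pi-sup norm of a truncated plaquette function `p ↦ if cond p.src then g p else 0`
# (the shape of the c₁ TEXT of record and of the stations' `E′`) is at most the sum over orientation pairs of `ρ_{μν}(sel μ ν)²` at SELECTED admissible sites — the
# `sel`∕`hsel` input of ✓`weighted_readMax_sq_le_sources(_T3)`, one engine run per orientation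

Cell `ym3-torus` (YM ladder rung R3 = continuum `SU(2)` Yang–Mills on the three-torus at fixed lattice data — a RUNG: NOT d = 4, NOT infinite volume, NOT a mass gap,
NOT Clay).  Width seat «width 16» `ym3-torus-px16` (gen 23), S2β pairing-letter lane holder; crux `stmt-QuantumFields-20520`, LINE g18-1 S2β.
`--kind proof --supports stmt-QuantumFields-20520 --as helper`, count-neutral, DEFINITION-FREE (0 `def`, 0 `instance`, 0 `notation`, 0 `sorry`, default heartbeats).

WHY.  c₁ TEXT v2 (ADOPTED, px17 g22 2026-08-31T19:51Z) is `Cst·Σ_B ‖(fun p : Plaq (F.P K) n_t => if ⟨read condition on p.src⟩ then dist1(relPlaq_n p) else 0)‖²`; the budget engine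
✓p832878∕✓p833397 reads a SITE function `ρ n` at ONE selected site `sel n B` per cell under the (M-3) clause `hsel`.  THIS FILE is the bridge: the Pi-sup is attained (finite
type), the maximiser's source is admissible when the truncation is on, and per orientation `(μ, ν)` the admissible argmax of `ρ_{μν}` dominates it — so
`‖trunc‖² ≤ Σ_μ Σ_ν ρ_{μν}(sel μ ν)²` with every `sel μ ν` admissible (`cond (sel μ ν)`), for ANY nonneg `ρ_{μν}` dominating `g` plaquette-wise.

WHAT IS PROVED (sorry-free; generic `P : Params`, any level `n`).
§1 ★`le_sqrt_sum_sum_sq` — one nonneg term is below the root of the double sum of squares.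
§2 ★★★`exists_sel_sq_pi_norm_trunc_le (cond) (hne : ∃ y, cond y) (g ≥ 0) (ρo) (hgρ : g p ≤ ρo p.μ p.ν p.src)` :
   `∃ sel : Fin d → Fin d → Site P n, (∀ μ ν, cond (sel μ ν)) ∧ ‖(fun p => if cond p.src then g p else 0)‖² ≤ Σ_μ Σ_ν ρo μ ν (sel μ ν)²`.

HONEST SCOPE.  Finite bookkeeping (Pi-sup norm on a finite type, argmax over a nonempty filter); nothing of Bałaban's analysis is asserted or proved ([Balaban1985Averaging] Prop. 4
(128)–(135) pp.37–38; [Balaban1987RG1] (0.11) p.253); rows, budgets, NC-ROW′, (ST‴), LOC‴, h3 HYPOTHESES elsewhere; GAP♯∘ (`stub_uniformFibreGapOrbit`, registry untouched, 0∕5), S2β,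
crux 20520, 19936, 19200 and `YM3TorusSU2` are NOT proved; no registered stub is closed; rung R3 = SU(2) YM₃ on T³ — NOT d = 4, NOT infinite volume, NOT a mass gap, NOT Clay; the
Yang–Mills mass gap is NOT proved.
-/

set_option autoImplicit false

noncomputable section

open Finset

namespace Summit.QuantumFields.YangMills.Theorems.FluctuationComparisonRegPrIntLS2BetaReadCellSelection

open Literature.MathematicalPhysics.QuantumFieldTheory.Balaban1983to89

variable {P : Params}

/-! ## §1 One term under the root of a double sum of squares -/

/-- ★ `a μ₀ ν₀ ≤ √(Σ_μ Σ_ν (a μ ν)²)`. [folklore] -/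
theorem le_sqrt_sum_sum_sq {ι : Type*} [Fintype ι] (a : ι → ι → ℝ) (μ₀ ν₀ : ι) :
    a μ₀ ν₀ ≤ Real.sqrt (∑ μ, ∑ ν, a μ ν ^ 2) := by
  refine Real.le_sqrt_of_sq_le ?_
  calc a μ₀ ν₀ ^ 2 ≤ ∑ ν, a μ₀ ν ^ 2 :=
        Finset.single_le_sum (f := fun ν => a μ₀ ν ^ 2) (fun ν _ => sq_nonneg _) (Finset.mem_univ ν₀)
    _ ≤ ∑ μ, ∑ ν, a μ ν ^ 2 :=
        Finset.single_le_sum (f := fun μ => ∑ ν, a μ ν ^ 2) (fun μ _ => Finset.sum_nonneg fun ν _ => sq_nonneg _) (Finset.mem_univ μ₀)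

/-! ## §2 The selection -/

/-- ★★★ **READ-CELL SELECTION**: for a decidable site predicate `cond` with a witness, a nonneg plaquette function `g` dominated plaquette-wise by site functions
`ρo μ ν` (one per orientation), there are ADMISSIBLE selected sites `sel μ ν` (`cond (sel μ ν)`) with
`‖(fun p => if cond p.src then g p else 0)‖² ≤ Σ_μ Σ_ν ρo μ ν (sel μ ν)²` (Pi-sup attained on the finite type; per orientation the admissible argmax dominates).
[cite: Balaban1985Averaging, Prop. 4 (128)-(135) pp.37-38; Balaban1987RG1, (0.11) p.253] -/
theorem exists_sel_sq_pi_norm_trunc_le {n : ℕ} (cond : Site P n → Prop) [DecidablePred cond] (hne : ∃ y, cond y)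
    (g : Plaq P n → ℝ) (hg : ∀ p, 0 ≤ g p) (ρo : Fin P.d → Fin P.d → Site P n → ℝ)
    (hgρ : ∀ p : Plaq P n, g p ≤ ρo p.μ p.ν p.src) :
    ∃ sel : Fin P.d → Fin P.d → Site P n, (∀ μ ν, cond (sel μ ν)) ∧
      ‖(fun p : Plaq P n => if cond p.src then g p else 0)‖ ^ 2 ≤ ∑ μ, ∑ ν, ρo μ ν (sel μ ν) ^ 2 := by
  classical
  -- the admissible set and, per orientation, an argmax of `ρo μ ν` over it
  set A : Finset (Site P n) := Finset.univ.filter (fun y => cond y) with hA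
  have hAne : A.Nonempty := by
    obtain ⟨y, hy⟩ := hne
    exact ⟨y, by rw [hA, Finset.mem_filter]; exact ⟨Finset.mem_univ _, hy⟩⟩
  have hsel : ∀ μ ν : Fin P.d, ∃ y ∈ A, ∀ y' ∈ A, ρo μ ν y' ≤ ρo μ ν y := fun μ ν => Finset.exists_max_image A (ρo μ ν) hAne
  choose sel hselA hselmax using hsel
  have hcond : ∀ μ ν, cond (sel μ ν) := fun μ ν => by
    have h := hselA μ ν
    rw [hA, Finset.mem_filter] at h
    exact h.2
  refine ⟨sel, hcond, ?_⟩
  -- the Pi-sup is below the root of the sum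
  set r : ℝ := Real.sqrt (∑ μ, ∑ ν, ρo μ ν (sel μ ν) ^ 2) with hr
  have hr0 : 0 ≤ r := Real.sqrt_nonneg _
  have hF : ‖(fun p : Plaq P n => if cond p.src then g p else 0)‖ ≤ r := by
    refine (pi_norm_le_iff_of_nonneg hr0).2 fun p => ?_
    by_cases hc : cond p.src
    · simp only [hc, if_true]
      rw [Real.norm_of_nonneg (hg p)]
      have hpA : p.src ∈ A := by rw [hA, Finset.mem_filter]; exact ⟨Finset.mem_univ _, hc⟩
      calc g p ≤ ρo p.μ p.ν p.src := hgρ p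
        _ ≤ ρo p.μ p.ν (sel p.μ p.ν) := hselmax p.μ p.ν p.src hpA
        _ ≤ r := by rw [hr]; exact le_sqrt_sum_sum_sq (fun μ ν => ρo μ ν (sel μ ν)) p.μ p.ν
    · simp only [hc, if_false, norm_zero]
      exact hr0
  have hF0 : 0 ≤ ‖(fun p : Plaq P n => if cond p.src then g p else 0)‖ := norm_nonneg _
  calc ‖(fun p : Plaq P n => if cond p.src then g p else 0)‖ ^ 2 ≤ r ^ 2 := pow_le_pow_left₀ hF0 hF 2
    _ = ∑ μ, ∑ ν, ρo μ ν (sel μ ν) ^ 2 := by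
        rw [hr, Real.sq_sqrt (Finset.sum_nonneg fun μ _ => Finset.sum_nonneg fun ν _ => sq_nonneg _)]

end Summit.QuantumFields.YangMills.Theorems.FluctuationComparisonRegPrIntLS2BetaReadCellSelection

end
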